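import Mathlib.MeasureTheory.Integral.DominatedConvergence
import Literature.Probability.LatticeModels.PlaneRotatorDuplicatedExpansion
import HarnessLib

/-!
# Lieb's inequality (23) for plane rotators with cleared denominators, via orientation counts

E. H. Lieb, *A refinement of Simon's correlation inequality*, Comm. Math. Phys. **77** (1980) 127–135 [Lieb1980],
inequality (23) for plane rotors, proved there for star-shaped inside systems and in general by V. Rivasseau,
*Lieb's correlation inequality for plane rotors*, Comm. Math. Phys. **77** (1980) 145–147 [Rivasseau1980]:
for `H_{A+C} = H_A + H_C` with pairwise ferromagnetic `cos` interactions and single spins `a ∈ A`, `c ∈ C`,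

  `⟨cos(θ_a − θ_c)⟩_{A+C} ≤ ∑_{b ∈ A ∩ C} ⟨cos(θ_a − θ_b)⟩_A ⟨cos(θ_b − θ_c)⟩_{A+C}`.

The tree's named fact `PlaneRotator.LiebRivasseauInequality` is discharged in `PlaneRotatorLiebRivasseauProof.lean`
(`liebRivasseauInequality_holds`, Poisson-current expansion). THIS file completes the independent
orientation-count route of `PlaneRotatorDuplicatedExpansion.lean` / `TorusCharacterExpansion.lean` /
`Literature.Combinatorics.Digraph.LiebOrientationCount` and records two statements the other file does not:

* `integral_mul_integral_le_sum` — **Lieb's (23) with cleared denominators in full generality** (any non-negative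
  `J_A` supported on `A × A` and `J_C` supported on `C × C`, overlapping and diagonal couplings allowed, `a ∈ A`
  arbitrary): `Z_A · (cos(θ_a − θ_c))_{A+C} ≤ ∑_{b ∈ A ∩ C} (cos(θ_a − θ_b))_A · (cos(θ_b − θ_c))_{A+C}` for the
  unnormalised expectations `(F)_J = ∫ F e^{∑ J cos}` (Lieb's (12));
* the dominated-convergence / expansion lemmas for the duplicated system with an arbitrary continuous observable
  (`integral_mul_expTrunc_dupHam`, `integral_mul_dupHam_pow`, `tendsto_integral_mul_expTrunc_dupHam`), reusable for
  other graphical inequalities of the plane-rotator model;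
Dividing `integral_mul_integral_le_sum` by `Z_A Z_{A+C} > 0` gives (23) itself, i.e. a second route to the landed
`liebRivasseauInequality_holds` (not restated here).

Proof of `integral_mul_integral_le_sum` (Lieb's reduction p. 132–133 made fully explicit): both sides are
integrals over the duplicated torus against `exp H_tot` (`integral_prod_mul`,
`ginibreWeight_mul_ginibreWeight_eq_exp_dupHam`); `exp = lim_L expTrunc_L` (dominated convergence);
`∫ O · expTrunc_L(H_tot) = ∑_{N<L} (∫ O H_tot^N)/N!`; `∫ O H_tot^N = ∑_g (∏ J) ∫ O ∏ φ` over words; words with a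
vanishing coefficient contribute nothing, the others have inside bonds in `A × A` and `C`-bonds in `C × C` by the
support hypotheses, and for them the coefficient inequality is `integral_obs_prod_dupCos_le` (Rivasseau's lemma via
`lieb_orientation_count_le`).

Not here: Lieb's abstract gluing Lemma 1 / hypotheses H.A1–H.C2 as separate statements; Ising versions; infinite
volume.
-/

noncomputable section

open MeasureTheory Filter Finset
open scoped Topology BigOperators

namespace Literature.Probability.LatticeModels

namespace PlaneRotator

open Literature.Combinatorics.Digraph

/-! ### Truncated exponentials and the limit -/

section Limit

/-- The truncated exponential is continuous (a polynomial). [folklore] -/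
private theorem continuous_expTrunc (L : ℕ) : Continuous (expTrunc L) := by
  unfold expTrunc
  exact continuous_finsetSum _ fun n _ => (continuous_pow n).div_const _

variable {V : Type*} [Fintype V] [MeasurableSpace Circle] [BorelSpace Circle]

/-- `∫ O · expTrunc_L(H_tot) = ∑_{N<L} (∫ O · H_tot^N)/N!`. [cite: Lieb1980, p. 133 (power series in β)] -/
theorem integral_mul_expTrunc_dupHam (JA JC : V × V → ℝ) {O : (V → Circle) × (V → Circle) → ℝ}
    (hO : Continuous O) (L : ℕ) :
    ∫ z, O z * expTrunc L (dupHam JA JC z) ∂((torusHaar V).prod (torusHaar V)) =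
      ∑ n ∈ Finset.range L, (∫ z, O z * dupHam JA JC z ^ n ∂((torusHaar V).prod (torusHaar V))) /
        (Nat.factorial n : ℝ) := by
  unfold expTrunc
  simp_rw [Finset.mul_sum]
  rw [integral_finsetSum _ fun n _ => ?_]
  · refine Finset.sum_congr rfl fun n _ => ?_
    rw [← integral_div]
    exact integral_congr_ae (ae_of_all _ fun z => by ring)
  · exact integrable_of_continuous_of_isFiniteMeasure _
      (hO.mul (((continuous_dupHam JA JC).pow n).div_const _))

/-- `∫ O · H_tot^N = ∑_g (∏ J_{g j}) ∫ O ∏_j φ_{g j}`. [cite: Lieb1980, p. 133 (power series in β)] -/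
theorem integral_mul_dupHam_pow (JA JC : V × V → ℝ) {O : (V → Circle) × (V → Circle) → ℝ}
    (hO : Continuous O) (n : ℕ) :
    ∫ z, O z * dupHam JA JC z ^ n ∂((torusHaar V).prod (torusHaar V)) =
      ∑ g : Fin n → (V × V) ⊕ (V × V), (∏ j, Sum.elim JA JC (g j)) *
        ∫ z, O z * ∏ j, dupCos (g j) z ∂((torusHaar V).prod (torusHaar V)) := by
  simp_rw [dupHam_pow_eq_sum, Finset.mul_sum]
  rw [integral_finsetSum _ fun g _ => ?_]
  · refine Finset.sum_congr rfl fun g _ => ?_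
    rw [← integral_const_mul]
    exact integral_congr_ae (ae_of_all _ fun z => by ring)
  · exact integrable_of_continuous_of_isFiniteMeasure _
      (hO.mul (continuous_const.mul (continuous_finsetProd _ fun j _ => continuous_dupCos _)))

/-- Dominated convergence: `∫ O · expTrunc_L(H_tot) → ∫ O · exp(H_tot)`. [cite: Lieb1980, p. 133 (power series in β)] -/
theorem tendsto_integral_mul_expTrunc_dupHam (JA JC : V × V → ℝ) {O : (V → Circle) × (V → Circle) → ℝ}
    (hO : Continuous O) :
    Tendsto (fun L => ∫ z, O z * expTrunc L (dupHam JA JC z) ∂((torusHaar V).prod (torusHaar V))) atTop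
      (𝓝 (∫ z, O z * Real.exp (dupHam JA JC z) ∂((torusHaar V).prod (torusHaar V)))) := by
  obtain ⟨B, hB⟩ := isCompact_univ.exists_bound_of_continuousOn (f := O) hO.continuousOn
  set M := ∑ i, |Sum.elim JA JC i| * 2 with hM
  refine tendsto_integral_of_dominated_convergence (fun _ => B * Real.exp M) ?_ (integrable_const _) ?_ ?_
  · exact fun L => (hO.mul ((continuous_expTrunc L).comp (continuous_dupHam JA JC))).aestronglyMeasurable
  · refine fun L => ae_of_all _ fun z => ?_
    rw [norm_mul, Real.norm_eq_abs, Real.norm_eq_abs]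
    exact mul_le_mul (hB z (Set.mem_univ z)) (abs_expTrunc_le (abs_dupHam_le JA JC z) L) (abs_nonneg _)
      ((norm_nonneg _).trans (hB z (Set.mem_univ z)))
  · exact ae_of_all _ fun z => (tendsto_expTrunc _).const_mul _

end Limit

/-! ### The inequality -/

section Main

variable {V : Type*} [Fintype V] [DecidableEq V] [MeasurableSpace Circle] [BorelSpace Circle]

/-- **Lieb's inequality (23) with cleared denominators**: for non-negative couplings `J_A` supported on `A × A`
and `J_C` supported on `C × C`, `a ∈ A`, `c ∈ C`,
`Z_A · (cos(θ_a − θ_c))_{A+C} ≤ ∑_{b ∈ A ∩ C} (cos(θ_a − θ_b))_A · (cos(θ_b − θ_c))_{A+C}` for the unnormalised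
expectations `(F)_J = ∫ F e^{∑ J cos}`. [cite: Lieb1980, eqs. (12), (23); Rivasseau1980 Theorem] -/
theorem integral_mul_integral_le_sum (A C : Finset V) (JA JC : V × V → ℝ) (hJA : ∀ p, 0 ≤ JA p)
    (hJC : ∀ p, 0 ≤ JC p) (hAs : ∀ p, JA p ≠ 0 → p.1 ∈ A ∧ p.2 ∈ A) (hCs : ∀ p, JC p ≠ 0 → p.1 ∈ C ∧ p.2 ∈ C)
    {a : V} (ha : a ∈ A) {c : V} (hc : c ∈ C) :
    (∫ θ, ginibreWeight (pairChars V) JA θ ∂torusHaar V) *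
        (∫ θ, cosDiff a c θ * ginibreWeight (pairChars V) (JA + JC) θ ∂torusHaar V) ≤
      ∑ b ∈ A ∩ C, (∫ θ, cosDiff a b θ * ginibreWeight (pairChars V) JA θ ∂torusHaar V) *
        (∫ θ, cosDiff b c θ * ginibreWeight (pairChars V) (JA + JC) θ ∂torusHaar V) := by
  -- Step 1: both sides as integrals over the duplicated torus
  have hL : (∫ θ, ginibreWeight (pairChars V) JA θ ∂torusHaar V) *
      (∫ θ, cosDiff a c θ * ginibreWeight (pairChars V) (JA + JC) θ ∂torusHaar V) =
      ∫ z, cosDiff a c z.2 * Real.exp (dupHam JA JC z) ∂((torusHaar V).prod (torusHaar V)) := by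
    rw [← integral_prod_mul]
    refine integral_congr_ae (ae_of_all _ fun z => ?_)
    simp only
    rw [← ginibreWeight_mul_ginibreWeight_eq_exp_dupHam]
    ring
  have hR : ∀ b, (∫ θ, cosDiff a b θ * ginibreWeight (pairChars V) JA θ ∂torusHaar V) *
      (∫ θ, cosDiff b c θ * ginibreWeight (pairChars V) (JA + JC) θ ∂torusHaar V) =
      ∫ z, (cosDiff a b z.1 * cosDiff b c z.2) * Real.exp (dupHam JA JC z)
        ∂((torusHaar V).prod (torusHaar V)) := by
    intro b
    rw [← integral_prod_mul]
    refine integral_congr_ae (ae_of_all _ fun z => ?_)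
    simp only
    rw [← ginibreWeight_mul_ginibreWeight_eq_exp_dupHam]
    ring
  have hOR : Continuous fun z : (V → Circle) × (V → Circle) => ∑ b ∈ A ∩ C, cosDiff a b z.1 * cosDiff b c z.2 :=
    continuous_finsetSum _ fun b _ =>
      ((continuous_cosDiff a b).comp continuous_fst).mul ((continuous_cosDiff b c).comp continuous_snd)
  have hOL : Continuous fun z : (V → Circle) × (V → Circle) => cosDiff a c z.2 :=
    (continuous_cosDiff a c).comp continuous_snd
  have hR' : ∑ b ∈ A ∩ C, (∫ θ, cosDiff a b θ * ginibreWeight (pairChars V) JA θ ∂torusHaar V) *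
      (∫ θ, cosDiff b c θ * ginibreWeight (pairChars V) (JA + JC) θ ∂torusHaar V) =
      ∫ z, (∑ b ∈ A ∩ C, cosDiff a b z.1 * cosDiff b c z.2) * Real.exp (dupHam JA JC z)
        ∂((torusHaar V).prod (torusHaar V)) := by
    simp_rw [hR, Finset.sum_mul]
    rw [integral_finsetSum _ fun b _ => ?_]
    exact integrable_of_continuous_of_isFiniteMeasure _
      ((((continuous_cosDiff a b).comp continuous_fst).mul ((continuous_cosDiff b c).comp continuous_snd)).mul
        (Real.continuous_exp.comp (continuous_dupHam JA JC)))
  rw [hL, hR']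
  -- Step 2: truncate the exponential and pass to the limit
  refine le_of_tendsto_of_tendsto' (tendsto_integral_mul_expTrunc_dupHam JA JC hOL)
    (tendsto_integral_mul_expTrunc_dupHam JA JC hOR) fun L => ?_
  -- Step 3: order by order
  rw [integral_mul_expTrunc_dupHam JA JC hOL, integral_mul_expTrunc_dupHam JA JC hOR]
  refine Finset.sum_le_sum fun n _ => div_le_div_of_nonneg_right ?_ (by positivity)
  rw [integral_mul_dupHam_pow JA JC hOL, integral_mul_dupHam_pow JA JC hOR]
  refine Finset.sum_le_sum fun g _ => ?_
  -- Step 4: word by word; words with a vanishing coefficient contribute nothing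
  by_cases hK : (∏ j, Sum.elim JA JC (g j)) = 0
  · rw [hK, zero_mul, zero_mul]
  have hK0 : 0 ≤ ∏ j, Sum.elim JA JC (g j) :=
    Finset.prod_nonneg fun j _ => by rcases g j with p | p <;> simp [hJA, hJC]
  have hne : ∀ j, Sum.elim JA JC (g j) ≠ 0 := fun j h0 => hK (Finset.prod_eq_zero (Finset.mem_univ j) h0)
  refine mul_le_mul_of_nonneg_left (integral_obs_prod_dupCos_le A C g (fun j hj => ?_) (fun j hj => ?_) ha hc) hK0
  · rw [insidePos, Finset.mem_filter] at hj
    have h := hne j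
    rcases hg : g j with p | q
    · rw [hg, Sum.elim_inl] at h
      exact hAs p h
    · rw [hg] at hj
      simp at hj
  · rw [insidePos, Finset.mem_filter] at hj
    have h := hne j
    rcases hg : g j with p | q
    · exact absurd ⟨Finset.mem_univ j, by rw [hg]; rfl⟩ hj
    · rw [hg, Sum.elim_inr] at h
      exact hCs q h

end Main

end PlaneRotator

end Literature.Probability.LatticeModels

end
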